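import Mathlib
import HarnessLib
import Literature.Analysis.FluidPDE.Tao2016AveragedNS.LocalCascadeSolutions
import Literature.Analysis.FluidPDE.Tao2016AveragedNS.RenormalisedCascadeWaves
import Summits.NavierStokesRegularity.NavierStokesRegularity.Theorems.TaoLadderRungTwoBreakEternalRigidityViscBddOneDefs
import Summits.NavierStokesRegularity.NavierStokesRegularity.Theorems.TaoLadderRungTwoBreakEternalRigidityViscBddOneFiringFloor
import Summits.NavierStokesRegularity.NavierStokesRegularity.Theorems.TaoLadderRungTwoBreakEternalRigidityViscBddOneFrontClock
import Summits.NavierStokesRegularity.NavierStokesRegularity.Theorems.WakeRatchetMinimalViscousBlowupClosedValve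

/-!
# Crux `TaoLadderRungTwoBreak.EternalRigidityViscBddOne` (stmt-NavierStokesRegularity-20420): the SCALE WINDOW of the critical front of a
# type-I viscous blow-up — between the self-similar scale `Λ^F ≳ 1/(t⋆−t)` and the dissipation scale `(1+ε₀)^{2F} ≲ 1/(ν(t⋆−t))`

MODEL lattice ODEs only (Tao 2016 §4: the exact NS-scaled `ν`-viscous cascade lattice of a table of `InTableClass R`, `m = 4`, from a one-shell
datum, registered vocabulary `ViscousUpTo` / `BlowsUpAt` / `TypeOne` of the skeleton `85fbfe8e90eea58b`); nothing here is a statement about the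
Navier–Stokes equations; no stub, crux or summit is closed (`--supports stmt-NavierStokesRegularity-20420`).

A critical-front mode `(i,F)` at time `t` (`Λ^F|X_{i,F}(t)|(t⋆−t) ≥ c⋆ = 1/(32(3+Λ))`, `CriticalRate.typeOne_quantity_lower_bound`) satisfies:
* `front_selfsimilar_scale` — LOWER position bound from the ENERGY bound `|X_{i,F}| ≤ (Σ_j X₀ⱼ²)^{1/2} =: S`
  (`FiringFloor.shellEnergy_le_datum_of_viscousUpTo`): `c⋆ ≤ S · Λ^F (t⋆−t)`, i.e. `Λ^F ≥ c⋆/(S(t⋆−t))` — the front sits at or above the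
  self-similar (inviscid type-I) scale; no type I needed;
* `front_scale_window_of_typeOne` — with `TypeOne`, at every late time both `c⋆ ≤ S·Λ^F(t⋆−t)` and `ν(1+ε₀)^{2F}(t⋆−t) < K₁`
  (`FrontClock.frontClock_of_typeOne`): in log-time `σ = −log(t⋆−t)` the critical-front shell obeys
  `(σ + log(c⋆/S))/log Λ ≤ F < (σ + log(K₁/ν))/(2 log(1+ε₀))` (`log Λ = (5/2)log(1+ε₀)`), so its AVERAGE log-time speed is pinned between
  `1/((5/2)log(1+ε₀))` and `1/(2 log(1+ε₀))` shells per unit log-time — an averaged two-sided hop clock (individual hops remain uncontrolled: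
  the window widens like `σ/(10 log(1+ε₀))` shells).
READING for ⟨20420⟩ (ω4): the missing dynamical input is the UNIFORM (not averaged) hop clock.  HONEST LABEL: bookkeeping; (ω3), (ω4), ⟨20420⟩
and every NS statement remain OPEN; rung 0.
-/

noncomputable section

-- the summit and its single sub-problem share the name (CONVENTIONS §1)
set_option linter.dupNamespace false

open Set Filter Topology
open Literature.Analysis.FluidPDE Literature.Analysis.FluidPDE.TaoCascade
open Summit.NavierStokesRegularity.NavierStokesRegularity.Theorems.MinimalViscousBlowup.ThresholdRay
open Summit.NavierStokesRegularity.NavierStokesRegularity.Theorems.EternalRigidityViscBddOne.Birth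
open Summit.NavierStokesRegularity.NavierStokesRegularity.Theorems.EternalRigidityViscBddOne.FiringFloor
open Summit.NavierStokesRegularity.NavierStokesRegularity.Theorems.EternalRigidityViscBddOne.FrontClock

namespace Summit.NavierStokesRegularity.NavierStokesRegularity.Theorems.EternalRigidityViscBddOne.CriticalFront

/-- **The critical front sits at or above the self-similar scale.**  Along `ViscousUpTo ε₀ ν α X₀ X t⋆` (table of `InTableClass R`, `ν > 0`),
a mode with `c ≤ Λ^F|X_{i,F}(t)|(t⋆−t)` has `c ≤ (Σ_j X₀ⱼ²)^{1/2} · Λ^F(t⋆−t)` (energy bound `‖X_F(t)‖² ≤ Σ_j X₀ⱼ²`).  MODEL lattice only.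
[cite: Tao2016AveragedNS, §4 proof of (4.13), Lemma 4.1 (4.5), (4.11); cell vocabulary (stmt-NavierStokesRegularity-20420)] -/
theorem front_selfsimilar_scale {R ε₀ ν : ℝ} (hε₀ : 0 < ε₀) (hν : 0 < ν)
    {α : Fin 4 → Fin 4 → Fin 4 → ℤ × ℤ × ℤ → ℝ} (hα : InTableClass R α) {X₀ : Fin 4 → ℝ}
    {X : Fin 4 → ℤ → ℝ → ℝ} {tStar : ℝ} (hV : ViscousUpTo ε₀ ν α X₀ X tStar) {t c : ℝ} (ht0 : 0 ≤ t) (htT : t < tStar)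
    {i : Fin 4} {F : ℤ} (hF : c ≤ bigLam ε₀ ^ F * |X i F t| * (tStar - t)) :
    c ≤ Real.sqrt (∑ j : Fin 4, X₀ j ^ 2) * (bigLam ε₀ ^ F * (tStar - t)) := by
  have hΛ : 0 < bigLam ε₀ := bigLam_pos (by linarith)
  have hX : |X i F t| ≤ Real.sqrt (∑ j : Fin 4, X₀ j ^ 2) := by
    have h1 := abs_apply_le_norm_shellVec X F t i
    have h2 := shellEnergy_le_datum_of_viscousUpTo hε₀ hν hα hV F t ht0 htT
    have h3 : ‖shellVec X F t‖ ≤ Real.sqrt (∑ j : Fin 4, X₀ j ^ 2) := by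
      rw [← Real.sqrt_sq (norm_nonneg (shellVec X F t))]
      exact Real.sqrt_le_sqrt h2
    exact h1.trans h3
  have hpos : 0 ≤ bigLam ε₀ ^ F * (tStar - t) := (mul_pos (zpow_pos hΛ F) (by linarith)).le
  calc c ≤ bigLam ε₀ ^ F * |X i F t| * (tStar - t) := hF
    _ = |X i F t| * (bigLam ε₀ ^ F * (tStar - t)) := by ring
    _ ≤ Real.sqrt (∑ j : Fin 4, X₀ j ^ 2) * (bigLam ε₀ ^ F * (tStar - t)) := mul_le_mul_of_nonneg_right hX hpos

/-- **THE SCALE WINDOW OF THE CRITICAL FRONT (type I).**  `ViscousUpTo ε₀ ν α X₀ X t⋆ ∧ TypeOne ε₀ X t⋆` (table of `InTableClass R`, `ν > 0`)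
⟹ `∃ K₁ > 0, ∃ t₁ < t⋆` such that every critical-front mode `(i,F)` at a time `t ∈ [t₁,t⋆)` (`Λ^F|X_{i,F}(t)|(t⋆−t) ≥ 1/(32(3+Λ))`) satisfies
BOTH `1/(32(3+Λ)) ≤ (Σ_j X₀ⱼ²)^{1/2}·Λ^F(t⋆−t)` (self-similar scale from below) AND `ν(1+ε₀)^{2F}(t⋆−t) < K₁` (dissipation scale from above):
the front wavenumber lives in the window `[(c⋆/(S(t⋆−t)))^{2/5}, (K₁/(ν(t⋆−t)))^{1/2}]`, an AVERAGED two-sided hop clock in log-time.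
MODEL lattice only.
[cite: Tao2016AveragedNS, §4 (4.1), the viscous equation before Thm. 4.2, §6.4; Teschl2012, §2.6; cell vocabulary (stmt-NavierStokesRegularity-20420)] -/
theorem front_scale_window_of_typeOne {R ε₀ ν : ℝ} (hε₀ : 0 < ε₀) (hν : 0 < ν)
    {α : Fin 4 → Fin 4 → Fin 4 → ℤ × ℤ × ℤ → ℝ} (hα : InTableClass R α) {X₀ : Fin 4 → ℝ}
    {X : Fin 4 → ℤ → ℝ → ℝ} {tStar : ℝ} (hV : ViscousUpTo ε₀ ν α X₀ X tStar) (hT1 : TypeOne ε₀ X tStar) :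
    ∃ K₁ t₁ : ℝ, 0 < K₁ ∧ t₁ < tStar ∧ ∀ t : ℝ, 0 ≤ t → t₁ ≤ t → t < tStar → ∀ (i : Fin 4) (F : ℤ),
      1 / (32 * (3 + bigLam ε₀)) ≤ bigLam ε₀ ^ F * |X i F t| * (tStar - t) →
        1 / (32 * (3 + bigLam ε₀)) ≤ Real.sqrt (∑ j : Fin 4, X₀ j ^ 2) * (bigLam ε₀ ^ F * (tStar - t)) ∧
          ν * (1 + ε₀) ^ ((2 : ℝ) * F) * (tStar - t) < K₁ := by
  obtain ⟨K₁, t₁, hK₁, ht₁, hclock⟩ := frontClock_of_typeOne hε₀ hν hα hV hT1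
  exact ⟨K₁, t₁, hK₁, ht₁, fun t ht0 ht1 htT i F hF =>
    ⟨front_selfsimilar_scale hε₀ hν hα hV ht0 htT hF, hclock t ht0 ht1 htT i F hF⟩⟩

end Summit.NavierStokesRegularity.NavierStokesRegularity.Theorems.EternalRigidityViscBddOne.CriticalFront

end
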